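import Summits.BirchSwinnertonDyer.BirchSwinnertonDyer.Theorems.ClassRecordThreeCornerAtThreeUpperHybrid
import HarnessLib

/-!
# Route `ClassRecordThree` (rung K2@3), crux 7 `CornerAtThree` (item stmt-BirchSwinnertonDyer-19111, shared with
# `KolyvaginRoadThree`), stub `stub_cornerUpper3` — the HYBRID reading, file 2: the classical (MONO-carrier) input asked only
# WHERE `3 ∣ ∏c` (cell `bsd-stepL`, width-lever second lane `bsd-stepL-corner3-p2` g2; `--supports stmt-BirchSwinnertonDyer-19111`)

HONEST FRAMING: theorems only (no definition, no named fact, no `sorry`); CONDITIONAL on the cited Literature facts listed BY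
NAME and on hypothesis-SHAPED open inputs; nothing asserted about any curve; item 19111 stays open; BSD is not advanced (T7).

File 1 (`…CornerAtThreeUpperHybrid.lean`, p538853) cut `Theorems.CornerAtThreeUpper` and lane B's open stub
`Theorems.CornerAtThreeCoStepL` into {J₃-MAX on MONO-carrier corner curves, `Three.CornerCoStepLAt` on MULTI-carrier corner
curves}. On the `3 ∤ ∏c` sub-corner (census 88 of 296 pairs, all non-split at 3) the mono condition holds trivially and the MAX
input is a vacuous-but-stated obligation (`s ≤ ord₃ c_v = 0`); here it is removed: `Three.CornerUpperAt W` is VACUOUS there (it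
carries the binder `3 ∣ ∏c`) and `Three.CornerCoStepLAt W` follows from the vacuous conjunct by g0's converse
(`cornerCoStepLAt_of_cornerUpperAt_of_facts`, Matar–Nekovář 2019 Thm. 0.3 inside). So the classical input of the hybrid is
asked EXACTLY on the mono-carrier curves with `3 ∣ ∏c` (census: 138 pairs), the IMC-grade input exactly on the multi-carrier
curves (70 pairs). References as in file 1.
-/

noncomputable section

open scoped Classical

namespace Summit.BirchSwinnertonDyer.Rank1Residual.X11b.Three

open scoped NumberField

open WeierstrassCurve IsDedekindDomain Literature.NumberTheory.EllipticCurves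
  Literature.NumberTheory.EllipticCurves.ModularForms
  Literature.NumberTheory.EllipticCurves.Rank1Residual
  Literature.NumberTheory.EllipticCurves.Rank1Residual.Typed
  Literature.NumberTheory.GaloisRepresentations Literature.NumberTheory.GaloisCohomology
  Summit.BirchSwinnertonDyer.Rank1Residual Summit.BirchSwinnertonDyer.Rank1Residual.X11b

/-! ### §1 The MONO stub asked only where `3 ∣ ∏c` — the `3 ∤ ∏c` sub-corner costs nothing

On a corner curve with `3 ∤ ∏_ℓ c_ℓ(E)` conjunct 3 `Three.CornerUpperAt W` is VACUOUS (it carries the binder `3 ∣ ∏c`), and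
lane B's `Three.CornerCoStepLAt W` follows from the vacuous conjunct by g0's converse (Matar–Nekovář inside). So the
classical input of the hybrid need only be asked on MONO-carrier curves WITH `3 ∣ ∏c` (census: exactly the 138 mono pairs,
not the 88 `t = 0` pairs on which `stub_upper3_jetchevMax` would otherwise be a vacuous-but-stated obligation). -/

/-- **`Three.CornerUpperAt W` is vacuous on the `3 ∤ ∏c` sub-corner** (the predicate carries `3 ∣ W.tamagawaProduct` as a
binder). Bookkeeping. [folklore] -/
theorem cornerUpperAt_of_not_dvd_tamagawaProduct (W : WeierstrassCurve ℚ) [W.IsElliptic] [W.IsGloballyMinimal]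
    (ht : ¬ 3 ∣ W.tamagawaProduct) : CornerUpperAt W :=
  fun _ _ _ _ _ _ _ _ _ _ _ ht' ↦ absurd ht' ht

/-- **THE HYBRID READING, sharpened: `Theorems.CornerAtThreeUpper` ⟸ { J₃-MAX on MONO-carrier corner curves WITH
`3 ∣ ∏c` (`hmaxMonoPos`), `Three.CornerCoStepLAt` on MULTI-carrier corner curves (`hcoMulti`) } + cited facts.** As
`cornerAtThreeUpper_of_jetchevMaxMono_of_coStepLMulti_of_facts`, with the `3 ∤ ∏c` curves discharged by vacuity.
CONDITIONAL on the two hypothesis-shaped inputs and the cited facts; closes nothing.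
[cite: Jetchev2008, Thm. 1.4 (shape)] [cite: Cha2005, Rmk. 25 (p. 175)]
[cite: JetchevSkinnerWan2017, §7.4.2 (eq:shaupper) (arXiv:1512.06894 p. 31)] -/
theorem cornerAtThreeUpper_of_jetchevMaxMonoPos_of_coStepLMulti_of_facts [Fact (Nat.Prime 3)]
    (hKo : ∀ (N : ℕ) [NeZero N] (W : WeierstrassCurve ℚ) (K : Type) [Field K] [NumberField K],
      kolyvagin N W K)
    (hrec : ∀ (N : ℕ) [NeZero N] (W : WeierstrassCurve ℚ) (K : Type) [Field K] [NumberField K],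
      heegnerPointOfConductor_one_galoisConj N W K)
    (hD36 : ∀ (N : ℕ) [NeZero N] (W : WeierstrassCurve ℚ) (K : Type) [Field K] [NumberField K],
      phi_heegnerTau_mem_singularModuliField N W K)
    (hChaU : Cha2005.rmk25_padicValNat_card_sha_primary_add_le_of_globalDivisibility)
    (hGZK : rank_eq_analyticRank_of_analyticRank_le_one) (hnf : exists_isNewformOf)
    (hPT : ∀ (K : Type) [Field K] [NumberField K], poitouTate_selmerStructure_duality K)
    (hPT2 : ∀ (K : Type) [Field K] [NumberField K], poitouTate_sha_tateDual K)
    -- OPEN INPUT 1 (classical): Jetchev MAX form on MONO-carrier corner curves WITH `3 ∣ ∏c`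
    (hmaxMonoPos : ∀ (W : WeierstrassCurve ℚ) [W.IsElliptic] [W.IsGloballyMinimal] [NeZero (W.conductorNorm ℤ)]
      (K : Type) [Field K] [NumberField K]
      (Dt : ModularParametrizationData W (W.conductorNorm ℤ)) (β : ℤ) (ι : K →+* ℂ),
      3 ∣ W.tamagawaProduct →
      (∃ v : HeightOneSpectrum (𝓞 ℚ),
        padicValNat 3 W.tamagawaProduct ≤ padicValNat 3 (W.tamagawaNumberAt v)) →
      ClassX11b W 3 → ¬ Surj W 3 →
      IsImaginaryQuadratic K → SatisfiesHeegnerHypothesis (W.conductorNorm ℤ) K →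
      Odd (NumberField.discr K) →
      (4 * (W.conductorNorm ℤ : ℤ)) ∣ β ^ 2 - NumberField.discr K → ¬ (3 : ℤ) ∣ Dt.c →
      ∀ (v : HeightOneSpectrum (𝓞 ℚ)) (s : ℕ), s ≤ padicValNat 3 (W.tamagawaNumberAt v) →
        ∀ (n : ℕ) (d : KolyvaginHeegnerData Dt β ι n), Squarefree n →
          (∀ ℓ ∈ n.primeFactors, Zhang2014.IsKolyvaginPrime (W.conductorNorm ℤ) W K 3 ℓ ∧
            s ≤ Zhang2014.kolyvaginIndex W 3 ℓ) → Koly.PDiv d 3 s)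
    -- OPEN INPUT 2 (IMC-grade, tight): the «⊇» half at 𝟙 on MULTI-carrier corner curves
    (hcoMulti : ∀ (W : WeierstrassCurve ℚ) [W.IsElliptic] [W.IsGloballyMinimal],
      (∀ v : HeightOneSpectrum (𝓞 ℚ),
        padicValNat 3 (W.tamagawaNumberAt v) < padicValNat 3 W.tamagawaProduct) →
      CornerCoStepLAt W) :
    Summit.BirchSwinnertonDyer.BirchSwinnertonDyer.Theorems.CornerAtThreeUpper := by
  intro W _ _
  by_cases ht : 3 ∣ W.tamagawaProduct
  · by_cases hmono : ∃ v : HeightOneSpectrum (𝓞 ℚ),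
        padicValNat 3 W.tamagawaProduct ≤ padicValNat 3 (W.tamagawaNumberAt v)
    · exact Koly.cornerUpperAt_of_jetchevMaxAt_of_monoCarrier hKo hrec hD36 hChaU W hmono
        (fun K _ _ Dt β ι hX hns hK hHN hodd hβ hc v s hs n d hn hℓ ↦
          hmaxMonoPos W K Dt β ι ht hmono hX hns hK hHN hodd hβ hc v s hs n d hn hℓ)
    · push Not at hmono
      exact cornerUpperAt_of_cornerCoStepLAt_of_facts W hGZK hnf hPT hPT2 (hcoMulti W hmono)
  · exact cornerUpperAt_of_not_dvd_tamagawaProduct W ht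

/-- **Lane B's registered open stub, sharpened cut: `Theorems.CornerAtThreeCoStepL` ⟸ { J₃-MAX on MONO-carrier corner
curves WITH `3 ∣ ∏c`, `Three.CornerCoStepLAt` on MULTI-carrier corner curves } + cited facts** — on `3 ∤ ∏c` curves the
vacuous conjunct 3 and g0's converse (Matar–Nekovář 2019 Thm. 0.3 inside) give the stub. CONDITIONAL; closes nothing.
[cite: MatarNekovar2019, Thm. 0.3 (p. 456)] [cite: Jetchev2008, Thm. 1.4 (shape)]
[cite: Castella2018, §5 (5.1)–(5.2) (arXiv:1704.06608 p. 12)] -/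
theorem cornerAtThreeCoStepL_of_jetchevMaxMonoPos_of_coStepLMulti_of_facts [Fact (Nat.Prime 3)]
    (hGZ : ∀ (N : ℕ) [NeZero N] (W : WeierstrassCurve ℚ) (K : Type) [Field K] [NumberField K],
      gross_zagier N W K)
    (hKo : ∀ (N : ℕ) [NeZero N] (W : WeierstrassCurve ℚ) (K : Type) [Field K] [NumberField K],
      kolyvagin N W K)
    (hmod : hasEntireLFunction_rat)
    (hGZK : rank_eq_analyticRank_of_analyticRank_le_one) (hnf : exists_isNewformOf)
    (hPT : ∀ (K : Type) [Field K] [NumberField K], poitouTate_selmerStructure_duality K)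
    (hPT2 : ∀ (K : Type) [Field K] [NumberField K], poitouTate_sha_tateDual K)
    (hMN : ∀ (N : ℕ) [NeZero N] (W : WeierstrassCurve ℚ) (K : Type) [Field K] [NumberField K],
      MatarNekovar2019.thm03_padicValNat_card_sha_le_of_irreducible N W K)
    (hrec : ∀ (N : ℕ) [NeZero N] (W : WeierstrassCurve ℚ) (K : Type) [Field K] [NumberField K],
      heegnerPointOfConductor_one_galoisConj N W K)
    (hD36 : ∀ (N : ℕ) [NeZero N] (W : WeierstrassCurve ℚ) (K : Type) [Field K] [NumberField K],
      phi_heegnerTau_mem_singularModuliField N W K)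
    (hChaU : Cha2005.rmk25_padicValNat_card_sha_primary_add_le_of_globalDivisibility)
    (hmaxMonoPos : ∀ (W : WeierstrassCurve ℚ) [W.IsElliptic] [W.IsGloballyMinimal] [NeZero (W.conductorNorm ℤ)]
      (K : Type) [Field K] [NumberField K]
      (Dt : ModularParametrizationData W (W.conductorNorm ℤ)) (β : ℤ) (ι : K →+* ℂ),
      3 ∣ W.tamagawaProduct →
      (∃ v : HeightOneSpectrum (𝓞 ℚ),
        padicValNat 3 W.tamagawaProduct ≤ padicValNat 3 (W.tamagawaNumberAt v)) →
      ClassX11b W 3 → ¬ Surj W 3 →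
      IsImaginaryQuadratic K → SatisfiesHeegnerHypothesis (W.conductorNorm ℤ) K →
      Odd (NumberField.discr K) →
      (4 * (W.conductorNorm ℤ : ℤ)) ∣ β ^ 2 - NumberField.discr K → ¬ (3 : ℤ) ∣ Dt.c →
      ∀ (v : HeightOneSpectrum (𝓞 ℚ)) (s : ℕ), s ≤ padicValNat 3 (W.tamagawaNumberAt v) →
        ∀ (n : ℕ) (d : KolyvaginHeegnerData Dt β ι n), Squarefree n →
          (∀ ℓ ∈ n.primeFactors, Zhang2014.IsKolyvaginPrime (W.conductorNorm ℤ) W K 3 ℓ ∧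
            s ≤ Zhang2014.kolyvaginIndex W 3 ℓ) → Koly.PDiv d 3 s)
    (hcoMulti : ∀ (W : WeierstrassCurve ℚ) [W.IsElliptic] [W.IsGloballyMinimal],
      (∀ v : HeightOneSpectrum (𝓞 ℚ),
        padicValNat 3 (W.tamagawaNumberAt v) < padicValNat 3 W.tamagawaProduct) →
      CornerCoStepLAt W) :
    Summit.BirchSwinnertonDyer.BirchSwinnertonDyer.Theorems.CornerAtThreeCoStepL := by
  intro W _ _
  by_cases ht : 3 ∣ W.tamagawaProduct
  · by_cases hmono : ∃ v : HeightOneSpectrum (𝓞 ℚ),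
        padicValNat 3 W.tamagawaProduct ≤ padicValNat 3 (W.tamagawaNumberAt v)
    · exact cornerCoStepLAt_of_jetchevMaxAt_of_monoCarrier_of_facts hGZ hKo hmod hGZK hnf hPT hPT2 hMN hrec hD36
        hChaU W hmono
        (fun K _ _ Dt β ι hX hns hK hHN hodd hβ hc v s hs n d hn hℓ ↦
          hmaxMonoPos W K Dt β ι ht hmono hX hns hK hHN hodd hβ hc v s hs n d hn hℓ)
    · push Not at hmono
      exact hcoMulti W hmono
  · exact cornerCoStepLAt_of_cornerUpperAt_of_facts W hGZ hKo hmod hGZK hnf hPT hPT2 hMN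
      (cornerUpperAt_of_not_dvd_tamagawaProduct W ht)

/-! ### §2 (appended) Ordering of the typed alternatives on the residue: lane A's full-depth divisibility ⟹ lane B's object -/

/-- **On any corner curve, lane A's FULL-DEPTH Jetchev divisibility at `W` (the shape of `stub_upper3_jetchevMulti`, without
its multi-carrier antecedent) implies lane B's `Three.CornerCoStepLAt W`, modulo cited facts** — lane A's cut per curve
(`Koly.cornerUpperAt_of_jetchevDivisibilityAt_of_irreducible`) followed by g0's converse (`cornerCoStepLAt_of_cornerUpperAt_of_facts`).
So among the typed IMC-grade alternatives for the multi-carrier residue the co-chain object is the WEAKER (hence preferable)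
stub: `jetchevMulti ⟹ coStepLMulti` (mod facts), while `coStepLMulti ⟺ the conjunct` (p529295 ∕ p532389). CONDITIONAL; closes
nothing. [cite: Jetchev2008, Conj. 1.3 (p. 812) (shape)] [cite: Cha2005, Rmk. 25 (p. 175)] [cite: MatarNekovar2019, Thm. 0.3 (p. 456)] -/
theorem cornerCoStepLAt_of_jetchevDivisibilityAt_of_facts [Fact (Nat.Prime 3)]
    (hGZ : ∀ (N : ℕ) [NeZero N] (W : WeierstrassCurve ℚ) (K : Type) [Field K] [NumberField K],
      gross_zagier N W K)
    (hKo : ∀ (N : ℕ) [NeZero N] (W : WeierstrassCurve ℚ) (K : Type) [Field K] [NumberField K],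
      kolyvagin N W K)
    (hmod : hasEntireLFunction_rat)
    (hGZK : rank_eq_analyticRank_of_analyticRank_le_one) (hnf : exists_isNewformOf)
    (hPT : ∀ (K : Type) [Field K] [NumberField K], poitouTate_selmerStructure_duality K)
    (hPT2 : ∀ (K : Type) [Field K] [NumberField K], poitouTate_sha_tateDual K)
    (hMN : ∀ (N : ℕ) [NeZero N] (W : WeierstrassCurve ℚ) (K : Type) [Field K] [NumberField K],
      MatarNekovar2019.thm03_padicValNat_card_sha_le_of_irreducible N W K)
    (hrec : ∀ (N : ℕ) [NeZero N] (W : WeierstrassCurve ℚ) (K : Type) [Field K] [NumberField K],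
      heegnerPointOfConductor_one_galoisConj N W K)
    (hD36 : ∀ (N : ℕ) [NeZero N] (W : WeierstrassCurve ℚ) (K : Type) [Field K] [NumberField K],
      phi_heegnerTau_mem_singularModuliField N W K)
    (hChaU : Cha2005.rmk25_padicValNat_card_sha_primary_add_le_of_globalDivisibility)
    (W : WeierstrassCurve ℚ) [W.IsElliptic] [W.IsGloballyMinimal]
    (hJW : ∀ [NeZero (W.conductorNorm ℤ)] (K : Type) [Field K] [NumberField K]
      (Dt : ModularParametrizationData W (W.conductorNorm ℤ)) (β : ℤ) (ι : K →+* ℂ),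
      ClassX11b W 3 → ¬ Surj W 3 →
      IsImaginaryQuadratic K → SatisfiesHeegnerHypothesis (W.conductorNorm ℤ) K →
      Odd (NumberField.discr K) →
      (4 * (W.conductorNorm ℤ : ℤ)) ∣ β ^ 2 - NumberField.discr K → ¬ (3 : ℤ) ∣ Dt.c →
      ∀ (s : ℕ), s ≤ padicValNat 3 W.tamagawaProduct →
        ∀ (n : ℕ) (d : KolyvaginHeegnerData Dt β ι n), Squarefree n →
          (∀ ℓ ∈ n.primeFactors, Zhang2014.IsKolyvaginPrime (W.conductorNorm ℤ) W K 3 ℓ ∧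
            s ≤ Zhang2014.kolyvaginIndex W 3 ℓ) → Koly.PDiv d 3 s) :
    CornerCoStepLAt W :=
  cornerCoStepLAt_of_cornerUpperAt_of_facts W hGZ hKo hmod hGZK hnf hPT hPT2 hMN
    (Koly.cornerUpperAt_of_jetchevDivisibilityAt_of_irreducible hKo hrec hD36 hChaU W hJW)

end Summit.BirchSwinnertonDyer.Rank1Residual.X11b.Three

end
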